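import Literature.MathematicalPhysics.QuantumLattice.SchwartzHalfSpaceCutoffB
import HarnessLib

/-!
# Smooth half-space cutoffs on multi-point Schwartz functions: uniform and tail bounds

Trunk **T-AQFT** (companion of `SchwartzHalfSpaceCutoff` / `SchwartzHalfSpaceCutoffB`), families
`constructive-qft`, `yang-mills`. For the cutoffs `cutLE crd θ`, `cutGE crd θ` on
`𝓢((Fin p → ℝᵈ), ℂ)`:

* `exists_bound_seminorm_cutLE` (…`cutGE`, …`sub_cutLE_uniform`, …`sub_cutGE_uniform`): the cutoffs
  and the remainders are bounded in every Schwartz seminorm **uniformly in `θ`**,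
  `‖cutLE crd θ F‖_{k,l} ≤ C sup_{≤ (k,l)} ‖F‖`;
* **the polynomial tail bound** `exists_bound_seminorm_sub_cutLE`: for all `k l N` there is `C` with
  `‖F - cutLE crd θ F‖_{k,l} ≤ C θ^{-N} sup_{≤ (k+N,l)} ‖F‖` for all `θ > 0` (the remainder lives where
  some `xⱼ[crd] ≥ θ`, hence where `‖x‖ ≥ θ`, and there `‖x‖^k ≤ θ^{-N} ‖x‖^{k+N}`); the mirror
  `exists_bound_seminorm_sub_cutGE` for `θ < 0` in `|θ|^{-N}`; the same in the tree's Schwartz norms,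
  `exists_bound_schwartzNorm_sub_cutLE : |F - cutLE crd θ F|_M ≤ C θ^{-N} |F|_{M+N}`;
* `tendsto_cutLE_atTop`, `tendsto_cutGE_atBot`: `cutLE crd θ F → F` in `𝓢` as `θ → +∞` and
  `cutGE crd θ F → F` as `θ → -∞`; `isPositiveTimeMulti_cutGE`: for `θ > 1` in the time coordinate
  the upper cutoff is positive-time (`IsPositiveTimeMulti`, OS's `𝒮₊`);
* `isOffDiagonal_cutLE`, …: the cutoffs and remainders preserve `⁰𝒮`
  (`Literature.MathematicalPhysics.AQFT.IsOffDiagonal`);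
* `cutLE_translateMulti : cutLE crd θ (translateMulti a F) = translateMulti a (cutLE crd (θ - a[crd]) F)`
  and the analogues: the cutoffs commute with diagonal translations up to shifting the threshold.

## Sources

Textbook folklore: L. Hörmander, *The Analysis of Linear Partial Differential Operators I*, §7.1
(proof of Lemma 7.1.8); K. Osterwalder, R. Schrader, *Axioms for Euclidean Green's functions*,
CMP 31 (1973), §2.

## Mathlib and Literature

From the tree: `SchwartzHalfSpaceCutoffA` (`seminorm_smulLeftCLM_le_of_bounds`,
`seminorm_smulLeftCLM_le_of_bounds_of_eq_zero`, `isOffDiagonal_smulLeftCLM`,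
`exists_bound_schwartzNorm_of_seminorm_le`), `SchwartzHalfSpaceCutoffB` (derivative bounds, pointwise
form), `EuclideanAction` (`translateMulti`), `SchwingerOSAxioms` (`schwartzNorm`).

## Build note

Expected tree imports: Literature.MathematicalPhysics.QuantumLattice.SchwartzHalfSpaceCutoffB (proposed; itself expects SchwartzHalfSpaceCutoff p110643 and SchwartzHalfSpaceCutoffA p110638).
This file was validated by elaborating the concatenation of the four parts
(`SchwartzHalfSpaceCutoff` + `A` + `B` + `C`, identical declarations, rc 0, no warnings) against the
tree while the Lean farm build of the freshly landed imports was still pending.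
-/

set_option autoImplicit false

open scoped SchwartzMap Topology ContDiff
open Filter Set

noncomputable section

namespace Literature.MathematicalPhysics.QuantumLattice

section HalfSpaceBounds

variable {d p : ℕ} (crd : Fin d) (θ : ℝ)

/-! ### Uniform seminorm bounds -/

/-- **The lower cutoffs are bounded on `𝓢` uniformly in the threshold**:
`‖cutLE crd θ F‖_{k,l} ≤ C sup_{(k',l') ≤ (k,l)} ‖F‖_{k',l'}` with `C` independent of `θ`
(Hörmander, ALPDO I §7.1; Osterwalder–Schrader 1973 §2). [folklore] -/
theorem exists_bound_seminorm_cutLE (k l : ℕ) :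
    ∃ C : ℝ, 0 ≤ C ∧ ∀ (θ : ℝ) (F : 𝓢((Fin p → EuclideanSpace ℝ (Fin d)), ℂ)),
      SchwartzMap.seminorm ℂ k l (cutLE crd θ F) ≤
        C * (Finset.Iic (k, l)).sup
          (schwartzSeminormFamily ℂ (Fin p → EuclideanSpace ℝ (Fin d)) ℂ) F := by
  obtain ⟨A, hA⟩ := exists_seq_bound_iteratedFDeriv_ofReal_wLE (p := p) crd
  have hA0 : ∀ i, 0 ≤ A i := fun i => (norm_nonneg _).trans (hA i 0 0)
  refine ⟨∑ i ∈ Finset.range (l + 1), (l.choose i : ℝ) * A i,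
    Finset.sum_nonneg fun i _ => mul_nonneg (Nat.cast_nonneg _) (hA0 i), fun θ' F => ?_⟩
  exact seminorm_smulLeftCLM_le_of_bounds ℂ (contDiff_ofReal_wLE crd θ') (fun i x => hA i θ' x) k l F

/-- **The upper cutoffs are bounded on `𝓢` uniformly in the threshold.** (Hörmander, ALPDO I §7.1;
Osterwalder–Schrader 1973 §2). [folklore] -/
theorem exists_bound_seminorm_cutGE (k l : ℕ) :
    ∃ C : ℝ, 0 ≤ C ∧ ∀ (θ : ℝ) (F : 𝓢((Fin p → EuclideanSpace ℝ (Fin d)), ℂ)),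
      SchwartzMap.seminorm ℂ k l (cutGE crd θ F) ≤
        C * (Finset.Iic (k, l)).sup
          (schwartzSeminormFamily ℂ (Fin p → EuclideanSpace ℝ (Fin d)) ℂ) F := by
  obtain ⟨A, hA⟩ := exists_seq_bound_iteratedFDeriv_ofReal_wGE (p := p) crd
  have hA0 : ∀ i, 0 ≤ A i := fun i => (norm_nonneg _).trans (hA i 0 0)
  refine ⟨∑ i ∈ Finset.range (l + 1), (l.choose i : ℝ) * A i,
    Finset.sum_nonneg fun i _ => mul_nonneg (Nat.cast_nonneg _) (hA0 i), fun θ' F => ?_⟩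
  exact seminorm_smulLeftCLM_le_of_bounds ℂ (contDiff_ofReal_wGE crd θ') (fun i x => hA i θ' x) k l F

/-- **The lower remainders are bounded on `𝓢` uniformly in the threshold**:
`‖F - cutLE crd θ F‖_{k,l} ≤ C sup_{(k',l') ≤ (k,l)} ‖F‖_{k',l'}` (Hörmander, ALPDO I §7.1;
Osterwalder–Schrader 1973 §2). [folklore] -/
theorem exists_bound_seminorm_sub_cutLE_uniform (k l : ℕ) :
    ∃ C : ℝ, 0 ≤ C ∧ ∀ (θ : ℝ) (F : 𝓢((Fin p → EuclideanSpace ℝ (Fin d)), ℂ)),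
      SchwartzMap.seminorm ℂ k l (F - cutLE crd θ F) ≤
        C * (Finset.Iic (k, l)).sup
          (schwartzSeminormFamily ℂ (Fin p → EuclideanSpace ℝ (Fin d)) ℂ) F := by
  obtain ⟨A, hA⟩ := exists_seq_bound_iteratedFDeriv_ofReal_one_sub_wLE (p := p) crd
  have hA0 : ∀ i, 0 ≤ A i := fun i => (norm_nonneg _).trans (hA i 0 0)
  refine ⟨∑ i ∈ Finset.range (l + 1), (l.choose i : ℝ) * A i,
    Finset.sum_nonneg fun i _ => mul_nonneg (Nat.cast_nonneg _) (hA0 i), fun θ' F => ?_⟩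
  rw [sub_cutLE_eq_smulLeftCLM]
  exact seminorm_smulLeftCLM_le_of_bounds ℂ (contDiff_ofReal_one_sub_wLE crd θ')
    (fun i x => hA i θ' x) k l F

/-- **The upper remainders are bounded on `𝓢` uniformly in the threshold.** (Hörmander, ALPDO I
§7.1; Osterwalder–Schrader 1973 §2). [folklore] -/
theorem exists_bound_seminorm_sub_cutGE_uniform (k l : ℕ) :
    ∃ C : ℝ, 0 ≤ C ∧ ∀ (θ : ℝ) (F : 𝓢((Fin p → EuclideanSpace ℝ (Fin d)), ℂ)),
      SchwartzMap.seminorm ℂ k l (F - cutGE crd θ F) ≤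
        C * (Finset.Iic (k, l)).sup
          (schwartzSeminormFamily ℂ (Fin p → EuclideanSpace ℝ (Fin d)) ℂ) F := by
  obtain ⟨A, hA⟩ := exists_seq_bound_iteratedFDeriv_ofReal_one_sub_wGE (p := p) crd
  have hA0 : ∀ i, 0 ≤ A i := fun i => (norm_nonneg _).trans (hA i 0 0)
  refine ⟨∑ i ∈ Finset.range (l + 1), (l.choose i : ℝ) * A i,
    Finset.sum_nonneg fun i _ => mul_nonneg (Nat.cast_nonneg _) (hA0 i), fun θ' F => ?_⟩
  rw [sub_cutGE_eq_smulLeftCLM]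
  exact seminorm_smulLeftCLM_le_of_bounds ℂ (contDiff_ofReal_one_sub_wGE crd θ')
    (fun i x => hA i θ' x) k l F

/-! ### Polynomial tail bounds -/

/-- **Polynomial tail bound for the lower remainder.** For all `k l N` there is `C` with
`‖F - cutLE crd θ F‖_{k,l} ≤ C θ^{-N} sup_{(k',l') ≤ (k+N,l)} ‖F‖_{k',l'}` for all `θ > 0` and all
`F`: the remainder lives where some `xⱼ[crd] ≥ θ`, so where `‖x‖ ≥ θ`, and there
`‖x‖^k ≤ θ^{-N} ‖x‖^{k+N}` (Hörmander, ALPDO I §7.1, proof of Lemma 7.1.8; Osterwalder–Schrader 1973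
§2). [folklore] -/
theorem exists_bound_seminorm_sub_cutLE (k l N : ℕ) :
    ∃ C : ℝ, 0 ≤ C ∧ ∀ θ : ℝ, 0 < θ → ∀ F : 𝓢((Fin p → EuclideanSpace ℝ (Fin d)), ℂ),
      SchwartzMap.seminorm ℂ k l (F - cutLE crd θ F) ≤
        C * θ⁻¹ ^ N * (Finset.Iic (k + N, l)).sup
          (schwartzSeminormFamily ℂ (Fin p → EuclideanSpace ℝ (Fin d)) ℂ) F := by
  obtain ⟨A, hA⟩ := exists_seq_bound_iteratedFDeriv_ofReal_one_sub_wLE (p := p) crd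
  have hA0 : ∀ i, 0 ≤ A i := fun i => (norm_nonneg _).trans (hA i 0 0)
  refine ⟨∑ i ∈ Finset.range (l + 1), (l.choose i : ℝ) * A i,
    Finset.sum_nonneg fun i _ => mul_nonneg (Nat.cast_nonneg _) (hA0 i), fun θ' hθ' F => ?_⟩
  rw [sub_cutLE_eq_smulLeftCLM]
  refine seminorm_smulLeftCLM_le_of_bounds_of_eq_zero ℂ (contDiff_ofReal_one_sub_wLE crd θ')
    (fun i x => hA i θ' x) hθ' (fun x hx => ?_) k l N F
  rw [wLE_eq_one_of_norm_lt hx, sub_self, Complex.ofReal_zero]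

/-- **Polynomial tail bound for the upper remainder.** For all `k l N` there is `C` with
`‖F - cutGE crd θ F‖_{k,l} ≤ C |θ|^{-N} sup_{(k',l') ≤ (k+N,l)} ‖F‖_{k',l'}` for all `θ < 0` and all
`F` (Hörmander, ALPDO I §7.1; Osterwalder–Schrader 1973 §2). [folklore] -/
theorem exists_bound_seminorm_sub_cutGE (k l N : ℕ) :
    ∃ C : ℝ, 0 ≤ C ∧ ∀ θ : ℝ, θ < 0 → ∀ F : 𝓢((Fin p → EuclideanSpace ℝ (Fin d)), ℂ),
      SchwartzMap.seminorm ℂ k l (F - cutGE crd θ F) ≤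
        C * |θ|⁻¹ ^ N * (Finset.Iic (k + N, l)).sup
          (schwartzSeminormFamily ℂ (Fin p → EuclideanSpace ℝ (Fin d)) ℂ) F := by
  obtain ⟨A, hA⟩ := exists_seq_bound_iteratedFDeriv_ofReal_one_sub_wGE (p := p) crd
  have hA0 : ∀ i, 0 ≤ A i := fun i => (norm_nonneg _).trans (hA i 0 0)
  refine ⟨∑ i ∈ Finset.range (l + 1), (l.choose i : ℝ) * A i,
    Finset.sum_nonneg fun i _ => mul_nonneg (Nat.cast_nonneg _) (hA0 i), fun θ' hθ' F => ?_⟩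
  rw [sub_cutGE_eq_smulLeftCLM]
  refine seminorm_smulLeftCLM_le_of_bounds_of_eq_zero ℂ (contDiff_ofReal_one_sub_wGE crd θ')
    (fun i x => hA i θ' x) (abs_pos.2 hθ'.ne) (fun x hx => ?_) k l N F
  rw [wGE_eq_one_of_norm_lt hx hθ', sub_self, Complex.ofReal_zero]

/-! ### The same bounds in the Schwartz norms `schwartzNorm` -/

/-- `|cutLE crd θ F|_M ≤ C |F|_M` uniformly in `θ` (Osterwalder–Schrader 1973 §2). [folklore] -/
theorem exists_bound_schwartzNorm_cutLE (M : ℕ) :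
    ∃ C : ℝ, 0 ≤ C ∧ ∀ (θ : ℝ) (F : 𝓢((Fin p → EuclideanSpace ℝ (Fin d)), ℂ)),
      schwartzNorm M (cutLE crd θ F) ≤ C * schwartzNorm M F :=
  exists_bound_schwartzNorm_of_seminorm_le_uniform
    (fun θ' (F : 𝓢((Fin p → EuclideanSpace ℝ (Fin d)), ℂ)) => cutLE crd θ' F)
    (exists_bound_seminorm_cutLE (p := p) crd) M

/-- `|cutGE crd θ F|_M ≤ C |F|_M` uniformly in `θ` (Osterwalder–Schrader 1973 §2). [folklore] -/
theorem exists_bound_schwartzNorm_cutGE (M : ℕ) :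
    ∃ C : ℝ, 0 ≤ C ∧ ∀ (θ : ℝ) (F : 𝓢((Fin p → EuclideanSpace ℝ (Fin d)), ℂ)),
      schwartzNorm M (cutGE crd θ F) ≤ C * schwartzNorm M F :=
  exists_bound_schwartzNorm_of_seminorm_le_uniform
    (fun θ' (F : 𝓢((Fin p → EuclideanSpace ℝ (Fin d)), ℂ)) => cutGE crd θ' F)
    (exists_bound_seminorm_cutGE (p := p) crd) M

/-- `|F - cutLE crd θ F|_M ≤ C |F|_M` uniformly in `θ` (Osterwalder–Schrader 1973 §2). [folklore] -/
theorem exists_bound_schwartzNorm_sub_cutLE_uniform (M : ℕ) :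
    ∃ C : ℝ, 0 ≤ C ∧ ∀ (θ : ℝ) (F : 𝓢((Fin p → EuclideanSpace ℝ (Fin d)), ℂ)),
      schwartzNorm M (F - cutLE crd θ F) ≤ C * schwartzNorm M F :=
  exists_bound_schwartzNorm_of_seminorm_le_uniform
    (fun θ' (F : 𝓢((Fin p → EuclideanSpace ℝ (Fin d)), ℂ)) => F - cutLE crd θ' F)
    (exists_bound_seminorm_sub_cutLE_uniform (p := p) crd) M

/-- `|F - cutGE crd θ F|_M ≤ C |F|_M` uniformly in `θ` (Osterwalder–Schrader 1973 §2). [folklore] -/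
theorem exists_bound_schwartzNorm_sub_cutGE_uniform (M : ℕ) :
    ∃ C : ℝ, 0 ≤ C ∧ ∀ (θ : ℝ) (F : 𝓢((Fin p → EuclideanSpace ℝ (Fin d)), ℂ)),
      schwartzNorm M (F - cutGE crd θ F) ≤ C * schwartzNorm M F :=
  exists_bound_schwartzNorm_of_seminorm_le_uniform
    (fun θ' (F : 𝓢((Fin p → EuclideanSpace ℝ (Fin d)), ℂ)) => F - cutGE crd θ' F)
    (exists_bound_seminorm_sub_cutGE_uniform (p := p) crd) M

/-- **Polynomial tail bound in Schwartz norms, lower remainder**: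
`|F - cutLE crd θ F|_M ≤ C θ^{-N} |F|_{M+N}` for `θ > 0` (Hörmander, ALPDO I §7.1;
Osterwalder–Schrader 1973 §2). [folklore] -/
theorem exists_bound_schwartzNorm_sub_cutLE (M N : ℕ) :
    ∃ C : ℝ, 0 ≤ C ∧ ∀ θ : ℝ, 0 < θ → ∀ F : 𝓢((Fin p → EuclideanSpace ℝ (Fin d)), ℂ),
      schwartzNorm M (F - cutLE crd θ F) ≤ C * θ⁻¹ ^ N * schwartzNorm (M + N) F :=
  exists_bound_schwartzNorm_of_seminorm_le
    (fun θ' (F : 𝓢((Fin p → EuclideanSpace ℝ (Fin d)), ℂ)) => F - cutLE crd θ' F) (fun θ' => 0 < θ')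
    (fun θ' => θ'⁻¹ ^ N) (fun _ hθ' => pow_nonneg (inv_nonneg.2 hθ'.le) N) N
    (fun k l => exists_bound_seminorm_sub_cutLE (p := p) crd k l N) M

/-- **Polynomial tail bound in Schwartz norms, upper remainder**:
`|F - cutGE crd θ F|_M ≤ C |θ|^{-N} |F|_{M+N}` for `θ < 0` (Hörmander, ALPDO I §7.1;
Osterwalder–Schrader 1973 §2). [folklore] -/
theorem exists_bound_schwartzNorm_sub_cutGE (M N : ℕ) :
    ∃ C : ℝ, 0 ≤ C ∧ ∀ θ : ℝ, θ < 0 → ∀ F : 𝓢((Fin p → EuclideanSpace ℝ (Fin d)), ℂ),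
      schwartzNorm M (F - cutGE crd θ F) ≤ C * |θ|⁻¹ ^ N * schwartzNorm (M + N) F :=
  exists_bound_schwartzNorm_of_seminorm_le
    (fun θ' (F : 𝓢((Fin p → EuclideanSpace ℝ (Fin d)), ℂ)) => F - cutGE crd θ' F) (fun θ' => θ' < 0)
    (fun θ' => |θ'|⁻¹ ^ N) (fun _ _ => pow_nonneg (inv_nonneg.2 (abs_nonneg _)) N) N
    (fun k l => exists_bound_seminorm_sub_cutGE (p := p) crd k l N) M

/-! ### Removing the cutoff: `cutLE crd θ F → F` as `θ → +∞`, `cutGE crd θ F → F` as `θ → -∞` -/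

/-- **The lower cutoffs converge to the identity** in `𝓢` as the threshold goes to `+∞`
(`‖F - cutLE crd θ F‖_{k,l} ≤ C θ⁻¹ sup ‖F‖`) (Hörmander, ALPDO I, Lemma 7.1.8;
Osterwalder–Schrader 1973 §2). [folklore] -/
theorem tendsto_cutLE_atTop (F : 𝓢((Fin p → EuclideanSpace ℝ (Fin d)), ℂ)) :
    Tendsto (fun θ : ℝ => cutLE crd θ F) atTop (𝓝 F) := by
  rw [(schwartz_withSeminorms ℂ (Fin p → EuclideanSpace ℝ (Fin d)) ℂ).tendsto_nhds]
  rintro ⟨k, l⟩ ε hε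
  obtain ⟨C, hC0, hC⟩ := exists_bound_seminorm_sub_cutLE (p := p) crd k l 1
  set S := (Finset.Iic (k + 1, l)).sup
    (schwartzSeminormFamily ℂ (Fin p → EuclideanSpace ℝ (Fin d)) ℂ) F with hS
  have hS0 : 0 ≤ S := apply_nonneg _ _
  filter_upwards [eventually_gt_atTop (max 1 ((C * S + 1) / ε))] with θ hθ
  have hθ1 : 1 < θ := (le_max_left _ _).trans_lt hθ
  have hθ0 : 0 < θ := one_pos.trans hθ1
  have hθε : (C * S + 1) / ε < θ := (le_max_right _ _).trans_lt hθ
  rw [SchwartzMap.schwartzSeminormFamily_apply, ← neg_sub, map_neg_eq_map]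
  calc SchwartzMap.seminorm ℂ k l (F - cutLE crd θ F) ≤ C * θ⁻¹ ^ 1 * S := hC θ hθ0 F
    _ = C * S / θ := by rw [pow_one, div_eq_mul_inv]; ring
    _ < ε := by
        rw [div_lt_iff₀ hθ0]
        rw [div_lt_iff₀ hε] at hθε
        nlinarith

/-- **The upper cutoffs converge to the identity** in `𝓢` as the threshold goes to `-∞`
(Hörmander, ALPDO I, Lemma 7.1.8; Osterwalder–Schrader 1973 §2). [folklore] -/
theorem tendsto_cutGE_atBot (F : 𝓢((Fin p → EuclideanSpace ℝ (Fin d)), ℂ)) :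
    Tendsto (fun θ : ℝ => cutGE crd θ F) atBot (𝓝 F) := by
  rw [(schwartz_withSeminorms ℂ (Fin p → EuclideanSpace ℝ (Fin d)) ℂ).tendsto_nhds]
  rintro ⟨k, l⟩ ε hε
  obtain ⟨C, hC0, hC⟩ := exists_bound_seminorm_sub_cutGE (p := p) crd k l 1
  set S := (Finset.Iic (k + 1, l)).sup
    (schwartzSeminormFamily ℂ (Fin p → EuclideanSpace ℝ (Fin d)) ℂ) F with hS
  have hS0 : 0 ≤ S := apply_nonneg _ _
  filter_upwards [eventually_lt_atBot (min (-1) (-((C * S + 1) / ε)))] with θ hθ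
  have hθ1 : θ < -1 := hθ.trans_le (min_le_left _ _)
  have hθ0 : θ < 0 := hθ1.trans (by norm_num)
  have hθε : (C * S + 1) / ε < |θ| := by
    rw [abs_of_neg hθ0]
    have h := hθ.trans_le (min_le_right _ _)
    linarith
  have hθpos : 0 < |θ| := abs_pos.2 hθ0.ne
  rw [SchwartzMap.schwartzSeminormFamily_apply, ← neg_sub, map_neg_eq_map]
  calc SchwartzMap.seminorm ℂ k l (F - cutGE crd θ F) ≤ C * |θ|⁻¹ ^ 1 * S := hC θ hθ0 F
    _ = C * S / |θ| := by rw [pow_one, div_eq_mul_inv]; ring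
    _ < ε := by
        rw [div_lt_iff₀ hθpos]
        rw [div_lt_iff₀ hε] at hθε
        nlinarith

/-! ### Positive-time support of the upper cutoff in the time coordinate -/

/-- For a threshold `θ > 1` in the time coordinate `0`, the upper cutoff produces positive-time test
functions: `supp (cutGE 0 θ F) ⊆ {x | ∀ j, 0 < xⱼ⁰}` (`IsPositiveTimeMulti`, OS 1973 §2 `𝒮₊`).
[folklore] -/
theorem isPositiveTimeMulti_cutGE [NeZero d] {θ : ℝ} (hθ : 1 < θ)
    (F : 𝓢((Fin p → EuclideanSpace ℝ (Fin d)), ℂ)) : IsPositiveTimeMulti (cutGE 0 θ F) :=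
  fun _ hx j => lt_of_lt_of_le (by linarith) ((tsupport_cutGE_subset 0 θ F hx).2 j)

/-- For a threshold `θ < -1` in the time coordinate `0`, the lower cutoff produces negative-time test
functions: `supp (cutLE 0 θ F) ⊆ {x | ∀ j, xⱼ⁰ < 0}` (OS 1973 §2 `𝒮₋`). [folklore] -/
theorem tsupport_cutLE_subset_neg [NeZero d] {θ : ℝ} (hθ : θ < -1)
    (F : 𝓢((Fin p → EuclideanSpace ℝ (Fin d)), ℂ)) :
    tsupport (cutLE 0 θ F : (Fin p → EuclideanSpace ℝ (Fin d)) → ℂ) ⊆ {x | ∀ j, x j 0 < 0} :=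
  fun _ hx j => lt_of_le_of_lt ((tsupport_cutLE_subset 0 θ F hx).2 j) (by linarith)

/-! ### Off-diagonality -/

open Literature.MathematicalPhysics.AQFT

/-- The lower cutoff preserves `⁰𝒮` (vanishing to infinite order at coincident points)
(Osterwalder–Schrader 1973 §2). [folklore] -/
theorem isOffDiagonal_cutLE {F : 𝓢((Fin p → EuclideanSpace ℝ (Fin d)), ℂ)} (hF : IsOffDiagonal F) :
    IsOffDiagonal (cutLE crd θ F) :=
  isOffDiagonal_smulLeftCLM (hasTemperateGrowth_ofReal_wLE crd θ) hF

/-- The upper cutoff preserves `⁰𝒮` (Osterwalder–Schrader 1973 §2). [folklore] -/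
theorem isOffDiagonal_cutGE {F : 𝓢((Fin p → EuclideanSpace ℝ (Fin d)), ℂ)} (hF : IsOffDiagonal F) :
    IsOffDiagonal (cutGE crd θ F) :=
  isOffDiagonal_smulLeftCLM (hasTemperateGrowth_ofReal_wGE crd θ) hF

/-- The lower remainder preserves `⁰𝒮` (Osterwalder–Schrader 1973 §2). [folklore] -/
theorem isOffDiagonal_sub_cutLE {F : 𝓢((Fin p → EuclideanSpace ℝ (Fin d)), ℂ)}
    (hF : IsOffDiagonal F) : IsOffDiagonal (F - cutLE crd θ F) := by
  rw [sub_cutLE_eq_smulLeftCLM]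
  exact isOffDiagonal_smulLeftCLM (hasTemperateGrowth_ofReal_one_sub_wLE crd θ) hF

/-- The upper remainder preserves `⁰𝒮` (Osterwalder–Schrader 1973 §2). [folklore] -/
theorem isOffDiagonal_sub_cutGE {F : 𝓢((Fin p → EuclideanSpace ℝ (Fin d)), ℂ)}
    (hF : IsOffDiagonal F) : IsOffDiagonal (F - cutGE crd θ F) := by
  rw [sub_cutGE_eq_smulLeftCLM]
  exact isOffDiagonal_smulLeftCLM (hasTemperateGrowth_ofReal_one_sub_wGE crd θ) hF

/-! ### Commutation with diagonal translations -/

/-- The lower weight after a diagonal translation: `wLE crd (θ - a[crd]) (x - a) = wLE crd θ x`.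
[folklore] -/
theorem wLE_sub_translate (a : EuclideanSpace ℝ (Fin d)) (x : Fin p → EuclideanSpace ℝ (Fin d)) :
    wLE crd (θ - a crd) (fun i => x i - a) = wLE crd θ x := by
  simp only [wLE, PiLp.sub_apply]
  exact Finset.prod_congr rfl fun j _ => by ring_nf

/-- The upper weight after a diagonal translation: `wGE crd (θ - a[crd]) (x - a) = wGE crd θ x`.
[folklore] -/
theorem wGE_sub_translate (a : EuclideanSpace ℝ (Fin d)) (x : Fin p → EuclideanSpace ℝ (Fin d)) :
    wGE crd (θ - a crd) (fun i => x i - a) = wGE crd θ x := by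
  simp only [wGE, PiLp.sub_apply]
  exact Finset.prod_congr rfl fun j _ => by ring_nf

/-- **The lower cutoff commutes with diagonal translations up to shifting the threshold**:
`cutLE crd θ (F(· - a)) = (cutLE crd (θ - a[crd]) F)(· - a)` (Osterwalder–Schrader 1973 §2). [folklore] -/
theorem cutLE_translateMulti (a : EuclideanSpace ℝ (Fin d))
    (F : 𝓢((Fin p → EuclideanSpace ℝ (Fin d)), ℂ)) :
    cutLE crd θ (translateMulti a F) = translateMulti a (cutLE crd (θ - a crd) F) := by
  ext x
  rw [cutLE_apply, translateMulti_apply, translateMulti_apply, cutLE_apply, wLE_sub_translate]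

/-- **The upper cutoff commutes with diagonal translations up to shifting the threshold**:
`cutGE crd θ (F(· - a)) = (cutGE crd (θ - a[crd]) F)(· - a)` (Osterwalder–Schrader 1973 §2). [folklore] -/
theorem cutGE_translateMulti (a : EuclideanSpace ℝ (Fin d))
    (F : 𝓢((Fin p → EuclideanSpace ℝ (Fin d)), ℂ)) :
    cutGE crd θ (translateMulti a F) = translateMulti a (cutGE crd (θ - a crd) F) := by
  ext x
  rw [cutGE_apply, translateMulti_apply, translateMulti_apply, cutGE_apply, wGE_sub_translate]

/-- The lower remainder commutes with diagonal translations up to shifting the threshold. [folklore] -/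
theorem sub_cutLE_translateMulti (a : EuclideanSpace ℝ (Fin d))
    (F : 𝓢((Fin p → EuclideanSpace ℝ (Fin d)), ℂ)) :
    translateMulti a F - cutLE crd θ (translateMulti a F) =
      translateMulti a (F - cutLE crd (θ - a crd) F) := by
  rw [cutLE_translateMulti, map_sub]

/-- The upper remainder commutes with diagonal translations up to shifting the threshold. [folklore] -/
theorem sub_cutGE_translateMulti (a : EuclideanSpace ℝ (Fin d))
    (F : 𝓢((Fin p → EuclideanSpace ℝ (Fin d)), ℂ)) :
    translateMulti a F - cutGE crd θ (translateMulti a F) =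
      translateMulti a (F - cutGE crd (θ - a crd) F) := by
  rw [cutGE_translateMulti, map_sub]

end HalfSpaceBounds

end Literature.MathematicalPhysics.QuantumLattice
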